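import Summits.PneNP.PneNP.Theses.DirichletPigeons

/-!
# Birth skeleton (BC3) for the split piece `GsaThresholdSearch` (support) — line `threshold-binary-search`

Piece 3 (support) of the split of `GsaPriceOfDimension`, route PneNP/DirichletPigeons:
`GsaThresholdSearch : ∀ δ > 0, gsaInExpTime δ → leastYesInExpTime δ` — a `2^{δ d}·poly` decider for
GSA yields a `2^{δ d}·poly` machine returning, on every valid DIRICHLET instance `J = (⟨d,a⟩, b, Q)`
whose threshold problem GSA`(a, b, ·, ε(b,Q))`, `ε(b,Q) = ⌊(b−1)/Q⌋/b`, has a YES bound `≤ Q^d`, the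
LEAST such bound (decision-to-search with dimension and exponent preserved).

LINE `threshold-binary-search` (two registered stubs + composition):
* `stub_thresholdOfGsa` (ORACLE RECODING): GSA ∈ TIME(2^{δd}·poly) ⇒ the THRESHOLD DECISION problem
  `(J, N) ↦ [GSA(J.a, J.b, N, ε(J.b, J.Q)) = YES]` on pairs `(J, N)` (code `encD`-pair-`encodeNat`) is in
  TIME(2^{δd}·poly): compute `ε(b,Q)` (one division), re-encode `(a, b, N, ε)` in the GSA format
  (length `≤ L + O(L)`), run the GSA machine; `d` unchanged.  TM plumbing over
  `Literature.Computability.Complexity.ComputesInTime` (composition of machines), size M.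
* `stub_searchOfThreshold` (BINARY SEARCH): threshold decision in TIME(2^{δd}·poly) ⇒ least-YES-bound
  search in TIME(2^{δd}·poly): `yes (a, b, N, ε)` is MONOTONE in `N`, so binary search over
  `N ∈ [1, Q^d]` finds the least YES bound with `d·log₂ Q + 1 ≤ L + 1` adaptive oracle calls, each on a
  pair of length `O(L)`; total time `(L+1)·(c·2^{δd}·(O(L)+1)^c + poly(L))`, again `expPoly δ`.  TM
  plumbing: a loop around a sub-machine (pattern of `Complexity/SearchToDecision.lean`), size M–L.
* `GsaThresholdSearch_of : stub_thresholdOfGsa → stub_searchOfThreshold → GsaThresholdSearch`.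

The piece is the ROUTE DECL `Summit.PneNP.PneNP.Theses.DirichletPigeons.GsaThresholdSearch` (rev ≥ 4), imported.
-/

set_option linter.dupNamespace false

namespace Summit.PneNP.PneNP.Cruxes.GsaPriceOfDimension.ThresholdBinarySearch

open scoped Classical
open Summit.PneNP.PneNP.Theses.DirichletPigeons (GsaThresholdSearch)
open Literature.Computability.Complexity

/-! ### Named forms of the route's inline vocabulary (definitionally the `let` bodies) -/

def dn : ℚ → ℚ := fun x => |x - ((round x : ℤ) : ℚ)|
def ivec : Computability.Encoding (Σ n : ℕ, Fin n → ℤ) Bool := Computability.Encoding.sigmaBool fun n => Literature.Computability.Complexity.encodingFinVec Literature.Computability.Complexity.encodingIntBool n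
def encG : ((Σ d : ℕ, Fin d → ℤ) × ℕ × ℕ × ℚ) → List Bool := fun I => Literature.Computability.Complexity.boolPair (ivec.encode I.1) (Literature.Computability.Complexity.boolPair (Computability.encodeNat I.2.1) (Literature.Computability.Complexity.boolPair (Computability.encodeNat I.2.2.1) ((Literature.Computability.Complexity.encodingIntBool.pairBool Computability.encodingNatBool).encode (I.2.2.2.num, I.2.2.2.den))))
def yes : ((Σ d : ℕ, Fin d → ℤ) × ℕ × ℕ × ℚ) → Prop := fun I => ∃ q : ℕ, 1 ≤ q ∧ q ≤ I.2.2.1 ∧ ∀ i : Fin I.1.1, dn ((q : ℚ) * I.1.2 i / I.2.1) ≤ I.2.2.2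
def expPoly : ℝ → (ℕ → ℕ → ℕ) → Prop := fun δ T => ∃ c : ℕ, ∀ n L : ℕ, (T n L : ℝ) ≤ c * (2 : ℝ) ^ (δ * n) * ((L : ℝ) + 1) ^ c
def gsaInExpTime : ℝ → Prop := fun δ => ∃ T : ℕ → ℕ → ℕ, expPoly δ T ∧ ∃ M, Literature.Computability.Complexity.ComputesInTime encG Computability.encodeBool (fun I => decide (yes I)) (fun I => T I.1.1 (encG I).length) M
def encD : ((Σ d : ℕ, Fin d → ℤ) × ℕ × ℕ) → List Bool := (ivec.pairBool (Computability.encodingNatBool.pairBool Computability.encodingNatBool)).encode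
/-- The Dirichlet threshold as a GSA tolerance: `ε(b, Q) = ⌊(b−1)/Q⌋ / b`. -/
def epsD : ((Σ d : ℕ, Fin d → ℤ) × ℕ × ℕ) → ℚ := fun J => ((((J.2.1 - 1) / J.2.2 : ℕ)) : ℚ) / (J.2.1 : ℚ)
def leastYes : ((Σ d : ℕ, Fin d → ℤ) × ℕ × ℕ) → ℕ → Prop := fun J N => 1 ≤ N ∧ N ≤ J.2.2 ^ J.1.1 ∧ yes (J.1, J.2.1, N, epsD J) ∧ ∀ N' : ℕ, 1 ≤ N' → N' < N → ¬ yes (J.1, J.2.1, N', epsD J)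
/-- "Least-YES-bound search at the Dirichlet threshold ∈ FTIME(2^{δ d}·poly)" — the conclusion of the piece. -/
def leastYesInExpTime : ℝ → Prop := fun δ => ∃ g : ((Σ d : ℕ, Fin d → ℤ) × ℕ × ℕ) → ℕ, (∀ J : (Σ d : ℕ, Fin d → ℤ) × ℕ × ℕ, 1 ≤ J.2.1 → 1 ≤ J.2.2 → (∃ N : ℕ, 1 ≤ N ∧ N ≤ J.2.2 ^ J.1.1 ∧ yes (J.1, J.2.1, N, epsD J)) → leastYes J (g J)) ∧ ∃ T : ℕ → ℕ → ℕ, expPoly δ T ∧ ∃ M, Literature.Computability.Complexity.ComputesInTime encD Computability.encodeNat g (fun J => T J.1.1 (encD J).length) M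

/-- The piece in the named vocabulary (definitional unfolding). -/
theorem gsaThresholdSearch_iff :
    Summit.PneNP.PneNP.Theses.DirichletPigeons.GsaThresholdSearch ↔ ∀ δ : ℝ, 0 < δ → gsaInExpTime δ → leastYesInExpTime δ := Iff.rfl

/-! ### The intermediate problem: THRESHOLD DECISION on pairs `(J, N)` -/

/-- Bit code of pairs `(J, N)`: `encD`-code of `J` paired with `encodeNat N`. -/
def encDN : (((Σ d : ℕ, Fin d → ℤ) × ℕ × ℕ) × ℕ) → List Bool := ((ivec.pairBool (Computability.encodingNatBool.pairBool Computability.encodingNatBool)).pairBool Computability.encodingNatBool).encode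

/-- "THRESHOLD DECISION ∈ TIME(2^{δ d}·poly)": the Boolean map `(J, N) ↦ [yes (J.a, J.b, N, ε(J.b, J.Q))]`
is computed within `T d L`, `expPoly δ T`, `L` = length of the pair code. -/
def thresholdInExpTime : ℝ → Prop := fun δ => ∃ T : ℕ → ℕ → ℕ, expPoly δ T ∧ ∃ M, Literature.Computability.Complexity.ComputesInTime encDN Computability.encodeBool (fun JN : ((Σ d : ℕ, Fin d → ℤ) × ℕ × ℕ) × ℕ => decide (yes (JN.1.1, JN.1.2.1, JN.2, epsD JN.1))) (fun JN => T JN.1.1.1 (encDN JN).length) M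

/-! ### Registered stubs -/

/-- STUB 1 (oracle recoding, dimension and exponent preserved): GSA ∈ TIME(2^{δd}·poly) ⇒ THRESHOLD
DECISION ∈ TIME(2^{δd}·poly). [Lagarias 1985 §1 (GSA vs Dirichlet's theorem); machine composition as in
Literature/Computability/Complexity/SearchToDecision.lean] -/
theorem stub_thresholdOfGsa : ∀ δ : ℝ, 0 < δ → gsaInExpTime δ → thresholdInExpTime δ := by
  sorry

/-- STUB 2 (binary search on the bound `N ∈ [1, Q^d]`, monotonicity of `yes` in `N`): THRESHOLD
DECISION ∈ TIME(2^{δd}·poly) ⇒ least-YES-bound search ∈ FTIME(2^{δd}·poly). [folklore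
decision-to-search; loop-around-a-sub-machine pattern of Complexity/SearchToDecision.lean] -/
theorem stub_searchOfThreshold : ∀ δ : ℝ, 0 < δ → thresholdInExpTime δ → leastYesInExpTime δ := by
  sorry

/-! ### Kernel-checked composition -/

/-- **The line concludes the piece**: `stub_thresholdOfGsa → stub_searchOfThreshold → GsaThresholdSearch`. -/
theorem GsaThresholdSearch_of :
    (∀ δ : ℝ, 0 < δ → gsaInExpTime δ → thresholdInExpTime δ) →
    (∀ δ : ℝ, 0 < δ → thresholdInExpTime δ → leastYesInExpTime δ) →
    Summit.PneNP.PneNP.Theses.DirichletPigeons.GsaThresholdSearch := by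
  intro h₁ h₂
  rw [gsaThresholdSearch_iff]
  exact fun δ hδ hG => h₂ δ hδ (h₁ δ hδ hG)

/-- **Skeleton certificate** (`ledger skeleton check`): the registered stubs prove the ROUTE DECL by name.
Depends on `sorry` exactly through the `stub_*` above. -/
theorem GsaThresholdSearch_proof : Summit.PneNP.PneNP.Theses.DirichletPigeons.GsaThresholdSearch :=
  GsaThresholdSearch_of stub_thresholdOfGsa stub_searchOfThreshold

end Summit.PneNP.PneNP.Cruxes.GsaPriceOfDimension.ThresholdBinarySearch
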